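import Summits.Ventures.Crystal3D.Theorems.StickyWulffConstantNoReconstructionGainWindowLoad
import HarnessLib

/-!
# The upper-half rows `a ∈ [−√(2/3)/2, 0]` of the `W = √(2/3)` windowed weighted-kissing certificate
# (crux `NoReconstructionGain`, stmt-Ventures-19144, line `replication-exactness`, inside `stub_noCriminal`)

HONEST FRAMING. Part of the venture `Summits/Ventures/Crystal3D` (cell `crystal3d-full`), helper `--supports` the
crux `NoReconstructionGain` (stmt-Ventures-19144, route `route-Ventures-StickyWulffConstant`), lead wulff-p1 g24.
A RUNG of the pointwise ("weighted kissing") method for height-confined `(111)` films; half of one window, not a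
film theorem, not a resolution of the crux.

`c = √(2/3)`.  The bilayer-hollow class «no `(111)` criminal with all balls below height `(k+2)c`» follows from
`ConfinedCodeBoundPhys c g` for ONE admissible profile `g` by `not_isCriminal_basal_of_confinedCodeBoundPhys`
(p718884).  For the clipped linear ramp `g z = min 2 (max 0 (1 − z/c))` the rows (offsets `a = (k+1)c − h` of a
ball at height `h`) known before this file: `a = 0` (`hollowRow_ramp`) and `a = −c` for partner counts `≠ 7, 8`
(`topRow_ramp_of_card_ne`).  THIS FILE: **every row `a ∈ [−c/2, 0]`** (`confinedRow_ramp_of_neg_half_le`) — all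
the PLUG-CARRYING offsets (plugs exist only for `|a| ≤ 1 − c < c/2`) and then some.  Proof: the partners of the
ball lie in the window `[a, a + c]` of height `c`; their ramp weights are `(1 − |u₂|/c) + (2/c)|u₂|·[u₂ < 0]`; the
first part totals `≤ 6` by the sliding-window bound `weightedWindowKissing_le_six` (`…WindowLoad`); the partners
strictly below the ball's equator are at most six (`card_band_le_six`, Musin: depth `≤ |a| ≤ 1/2`) and each has
`|u₂| ≤ |a|`, so the excess is `≤ 12|a|/c ≤ 6` exactly up to `|a| = c/2`; plugs (third coordinate `a − c`) weigh
`2` each and number `m` with `m(c + |a|)² ≤ (m+1)/2` (`card_mul_sq_le_of_sameHeight`): `m ≤ 3`, `m = 3` forces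
`a = 0`, `m = 2` forces `|a| ≤ √3/2 − c < 0.06`, `m = 1` forces `|a| ≤ 1 − c < 0.19` — and in each regime
`2m + 6 + 12|a|/c ≤ 12`.

WHAT IS LEFT of the `W = c` window: the plug-free rows `a ∈ [−c, −c/2)` — at `a = −c` only the partner counts
`7, 8` — all with numerical slack (cell memo HOLLOW-g24 §2), i.e. certificate-shaped; none is claimed here.
Rung F-C1 not moved.
-/

noncomputable section

namespace Summit.Ventures.Crystal3D.Theorems

open Finset Real
open scoped InnerProductSpace

/-! ## 4. The rows `a ∈ [−c/2, 0]` of `ConfinedCodeBoundPhys √(2/3) ramp` -/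

/-- The third coordinate is the `e₃`-height (local copy). -/
private theorem inner_e3_window (v : EuclideanSpace ℝ (Fin 3)) :
    ⟪EuclideanSpace.single 2 (1 : ℝ), v⟫_ℝ = v 2 := by
  rw [real_inner_comm, EuclideanSpace.inner_single_right]; simp

/-- **The upper-half rows of the `W = √(2/3)` certificate.**  For every offset `a ∈ [−√(2/3)/2, 0]` and every
finite `60°`-code `N` each of whose members has third coordinate exactly `a − √(2/3)` (plugs) or in the window
`[a, a + √(2/3)]` (partners), the clipped-linear-ramp weight satisfies `Σ_{u ∈ N} min 2 (max 0 (1 − u₂/√(2/3))) ≤ 12`.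
Proof: plugs weigh `2` and number `m ≤ 3` with `m(√(2/3) − a)² ≤ (m+1)/2` (`card_mul_sq_le_of_sameHeight`);
partners weigh `(1 − |u₂|/c) + (2/c)|u₂|·[u₂ < 0]`: the first part totals `≤ 6` (`weightedWindowKissing_le_six`
with `d = −a`), the sub-equatorial partners are at most six (`card_band_le_six`, depth `≤ |a| ≤ 1/2`) and each
has `|u₂| ≤ |a|`; so the total is `≤ 2m + 6 + 12|a|/c ≤ 12` in each plug regime. -/
theorem confinedRow_ramp_of_neg_half_le {a : ℝ} (ha : -(Real.sqrt (2 / 3) / 2) ≤ a) (ha0 : a ≤ 0)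
    (N : Finset (EuclideanSpace ℝ (Fin 3))) (h1 : ∀ u ∈ N, ‖u‖ = 1)
    (h2 : ∀ u ∈ N, ∀ v ∈ N, u ≠ v → ⟪u, v⟫_ℝ ≤ 1 / 2)
    (hwin : ∀ u ∈ N, u 2 = a - Real.sqrt (2 / 3) ∨ (a ≤ u 2 ∧ u 2 ≤ a + Real.sqrt (2 / 3))) :
    ∑ u ∈ N, min 2 (max 0 (1 - u 2 / Real.sqrt (2 / 3))) ≤ 12 := by
  classical
  set c : ℝ := Real.sqrt (2 / 3) with hc
  have hc2 : c ^ 2 = 2 / 3 := Real.sq_sqrt (by norm_num)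
  have hcpos : 0 < c := Real.sqrt_pos.2 (by norm_num)
  have hc81 : (81 : ℝ) / 100 < c := by nlinarith
  have hc82 : c < 82 / 100 := by nlinarith
  set d : ℝ := -a with hd
  have hd0 : 0 ≤ d := by rw [hd]; linarith
  have hdc2 : d ≤ c / 2 := by rw [hd]; linarith
  have hdc : d ≤ c := by linarith
  -- the three parts of the code
  set P := N.filter (fun u => u 2 = a - c) with hP
  set W := N.filter (fun u => -d ≤ u 2 ∧ u 2 ≤ c - d) with hW
  have hPmem : ∀ u, u ∈ P ↔ u ∈ N ∧ u 2 = a - c := fun u => by rw [hP, mem_filter]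
  have hWmem : ∀ u, u ∈ W ↔ u ∈ N ∧ -d ≤ u 2 ∧ u 2 ≤ c - d := fun u => by rw [hW, mem_filter]
  have hdisj : Disjoint P W := by
    rw [Finset.disjoint_left]
    intro u huP huW
    have e1 := ((hPmem u).1 huP).2
    have e2 := ((hWmem u).1 huW).2.1
    rw [hd] at e2
    linarith
  have hunion : N = P ∪ W := by
    ext u
    rw [mem_union, hPmem, hWmem]
    constructor
    · intro hu
      rcases hwin u hu with h | h
      · exact Or.inl ⟨hu, h⟩
      · exact Or.inr ⟨hu, by rw [hd]; linarith [h.1], by rw [hd]; linarith [h.2]⟩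
    · rintro (h | h)
      · exact h.1
      · exact h.1
  -- plug weights and count
  have hPw : ∀ u ∈ P, min 2 (max 0 (1 - u 2 / c)) = 2 := by
    intro u hu
    have e := ((hPmem u).1 hu).2
    have : 2 ≤ 1 - u 2 / c := by
      rw [e, sub_div, div_self hcpos.ne']
      have : a / c ≤ 0 := div_nonpos_of_nonpos_of_nonneg ha0 hcpos.le
      linarith
    rw [max_eq_right (by linarith), min_eq_left this]
  have hPsum : ∑ u ∈ P, min 2 (max 0 (1 - u 2 / c)) = 2 * P.card := by
    rw [Finset.sum_congr rfl hPw, sum_const, nsmul_eq_mul, mul_comm]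
  have hPsq := card_mul_sq_le_of_sameHeight P (a - c) (fun u hu => h1 u ((hPmem u).1 hu).1)
    (fun u hu v hv huv => h2 u ((hPmem u).1 hu).1 v ((hPmem v).1 hv).1 huv) (fun u hu => ((hPmem u).1 hu).2)
  have hsq : (a - c) ^ 2 = (c + d) ^ 2 := by rw [hd]; ring
  rw [hsq] at hPsq
  -- partner weights: `g = (1 − |u₂|/c) + (2/c) |u₂| [u₂ < 0]`
  set B := W.filter (fun u => u 2 < 0) with hB
  have hBmem : ∀ u, u ∈ B ↔ u ∈ W ∧ u 2 < 0 := fun u => by rw [hB, mem_filter]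
  have hWw : ∀ u ∈ W, min 2 (max 0 (1 - u 2 / c)) = 1 - u 2 / c := by
    intro u hu
    have h := (hWmem u).1 hu
    have hlo : 0 ≤ 1 - u 2 / c := by
      rw [sub_nonneg, div_le_one hcpos]; linarith [h.2.2]
    have hhi : 1 - u 2 / c ≤ 2 := by
      have : -1 ≤ u 2 / c := by rw [le_div_iff₀ hcpos]; linarith [h.2.1]
      linarith
    rw [max_eq_right hlo, min_eq_right hhi]
  have hBif : ∑ u ∈ B, 2 * |u 2| / c = ∑ u ∈ W, if u 2 < 0 then 2 * |u 2| / c else 0 := by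
    rw [hB]; exact Finset.sum_filter _ _
  have hWsplit : ∑ u ∈ W, (1 - u 2 / c) =
      ∑ u ∈ W, (1 - |u 2| / c) + ∑ u ∈ B, 2 * |u 2| / c := by
    rw [hBif, ← sum_add_distrib]
    refine Finset.sum_congr rfl fun u _ => ?_
    split_ifs with h
    · rw [abs_of_neg h]; ring
    · push Not at h
      rw [abs_of_nonneg h]; ring
  -- the sliding window bound
  have hW6 : ∑ u ∈ W, (1 - |u 2| / c) ≤ 6 := by
    have := weightedWindowKissing_le_six N h1 h2 hd0 hdc
    rw [← hW] at this
    exact this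
  -- the sub-equatorial partners: at most six, each of depth `≤ d`
  have hBN : ∀ u ∈ B, u ∈ N := fun u hu => ((hWmem u).1 ((hBmem u).1 hu).1).1
  have hB6 : B.card ≤ 6 := by
    set e : EuclideanSpace ℝ (Fin 3) := -EuclideanSpace.single 2 (1 : ℝ) with he
    have hen : ‖e‖ = 1 := by rw [he, norm_neg, PiLp.norm_single, norm_one]
    have hein : ∀ v : EuclideanSpace ℝ (Fin 3), ⟪e, v⟫_ℝ = -v 2 := by
      intro v; rw [he, inner_neg_left, inner_e3_window]
    refine Literature.Geometry.DiscreteGeometry.card_band_le_six hen (fun u hu => h1 u (hBN u hu))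
      (fun u hu => ?_) (fun u hu => ?_) (fun u hu w hw huw => h2 u (hBN u hu) w (hBN w hw) huw)
    · rw [hein]; linarith [((hBmem u).1 hu).2]
    · rw [hein]
      have := ((hWmem u).1 ((hBmem u).1 hu).1).2.1
      linarith
  have hBsum : ∑ u ∈ B, 2 * |u 2| / c ≤ 2 * (B.card : ℝ) * d / c := by
    have hle : ∀ u ∈ B, 2 * |u 2| / c ≤ 2 * d / c := by
      intro u hu
      have hw := (hWmem u).1 ((hBmem u).1 hu).1
      have hneg := ((hBmem u).1 hu).2
      have : |u 2| ≤ d := by rw [abs_of_neg hneg]; linarith [hw.2.1]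
      gcongr
    calc ∑ u ∈ B, 2 * |u 2| / c ≤ ∑ u ∈ B, 2 * d / c := Finset.sum_le_sum hle
      _ = 2 * (B.card : ℝ) * d / c := by rw [sum_const, nsmul_eq_mul]; ring
  have hB6' : (B.card : ℝ) ≤ 6 := by exact_mod_cast hB6
  have hBsum' : ∑ u ∈ B, 2 * |u 2| / c ≤ 12 * d / c := by
    calc ∑ u ∈ B, 2 * |u 2| / c ≤ 2 * (B.card : ℝ) * d / c := hBsum
      _ ≤ 2 * 6 * d / c := by gcongr
      _ = 12 * d / c := by ring
  -- assemble
  rw [hunion, sum_union hdisj, hPsum, Finset.sum_congr rfl hWw, hWsplit]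
  -- plug regimes
  have hcd : 2 / 3 ≤ (c + d) ^ 2 := by nlinarith [hc2]
  have hm3 : (P.card : ℝ) ≤ 3 := by
    have hm0' : (0 : ℝ) ≤ P.card := Nat.cast_nonneg _
    have : (P.card : ℝ) * (2 / 3) ≤ ((P.card : ℝ) + 1) / 2 :=
      le_trans (mul_le_mul_of_nonneg_left hcd hm0') hPsq
    linarith
  have h3nat : P.card ≤ 3 := by exact_mod_cast hm3
  -- the final arithmetic, by plug regime (`m = #P ∈ {0,1,2,3}`), on the three scalar quantities
  set SW := ∑ u ∈ W, (1 - |u 2| / c) with hSW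
  set SB := ∑ u ∈ B, 2 * |u 2| / c with hSB
  set m : ℝ := (P.card : ℝ) with hm
  have hSB12 : SB * c ≤ 12 * d := by
    have := hBsum'; rwa [le_div_iff₀ hcpos] at this
  have hexp : m * (c + d) ^ 2 = m * c ^ 2 + 2 * m * (c * d) + m * d ^ 2 := by ring
  have hd2 : 0 ≤ d ^ 2 := sq_nonneg d
  -- `m` is a natural number `≤ 3`
  have hmcases : m = 0 ∨ m = 1 ∨ m = 2 ∨ m = 3 := by
    rw [hm]
    interval_cases P.card <;> simp
  rcases hmcases with h0 | h1 | h2 | h3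
  · -- no plugs: `SB·c ≤ 12 d ≤ 6 c`
    rw [h0]
    nlinarith only [hW6, hSB12, hdc2, hcpos, hd0]
  · -- one plug: `(c + d)² ≤ 1` ⇒ `d ≤ 1 − c < 0.19` ⇒ `SB < 3`
    rw [h1] at hPsq ⊢
    have hd1 : c + d ≤ 1 := by nlinarith only [hPsq, hcpos, hd0]
    nlinarith only [hW6, hSB12, hcpos, hd0, hd1, hc81]
  · -- two plugs: `2(c + d)² ≤ 3/2` ⇒ `c + d ≤ 0.87` ⇒ `SB < 1`
    rw [h2] at hPsq ⊢
    have hd1 : c + d ≤ 87 / 100 := by nlinarith only [hPsq, hcpos, hd0]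
    nlinarith only [hW6, hSB12, hcpos, hd0, hd1, hc81]
  · -- three plugs: `3(c + d)² ≤ 2` forces `d = 0`, `SB = 0`
    rw [h3] at hexp hPsq ⊢
    have hcd1 : c * d ≤ c * 0 := by rw [mul_zero]; nlinarith only [hPsq, hexp, hc2, hd2]
    have hdle : d ≤ 0 := le_of_mul_le_mul_left hcd1 hcpos
    have hd00 : d = 0 := le_antisymm hdle hd0
    rw [hd00, mul_zero] at hSB12
    have hSB0 : SB ≤ 0 := by
      have : SB * c ≤ 0 * c := by rw [zero_mul]; exact hSB12
      exact le_of_mul_le_mul_right this hcpos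
    linarith only [hW6, hSB0]

end Summit.Ventures.Crystal3D.Theorems

end
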